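import Summits.BirchSwinnertonDyer.BirchSwinnertonDyer.Theses.UniversalToricDescent
import Summits.BirchSwinnertonDyer.BirchSwinnertonDyer.Theorems.WildThreeRankOneBSDpOfExactIndexManin
import Summits.BirchSwinnertonDyer.BirchSwinnertonDyer.Theorems.SchneiderFreeAdditiveX3UpperReceptacle
import Summits.BirchSwinnertonDyer.BirchSwinnertonDyer.Theorems.ClassRecordThreeStepLOfHalvesB
import Summits.BirchSwinnertonDyer.Rank1Residual.GaloisImage.TorsionIsoImageObstruction
import Literature.NumberTheory.EllipticCurves.BSDHeegnerPointsGrossZagierProofs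
import Literature.NumberTheory.EllipticCurves.KrizLi2019.SexticTwistBSDThreeDescent
import Literature.NumberTheory.EllipticCurves.GlobalMinimalModelProofs
import Literature.NumberTheory.EllipticCurves.ModularCurveManinConstantProofs
import HarnessLib

/-!
# Route `UniversalToricDescent`: the TWIN-CHOICE form of the kernel — crux #3 `TwinSplitIMCAtThree`
# is consumed ONLY at the one twin handed over by the leaf, at a Heegner field with `d_K` odd

Cell `bsd-wall` (W-ALL, lane 3, row 2·3@3), seat `bsd-wall-utd-p2` g6 (prover, explicit-unit, strategy
«twin-split IMC at 3, ⊇-half only»), 2026-08-27. `--supports stmt-BirchSwinnertonDyer-20695`.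

The route's kernel `ToricKernelAtThree` (item 20390, `universalToricDescent_toricKernelAtThree_proof`,
seat utd-p3 g0) takes crux #3 `TwinSplitIMCAtThree` (item 20214) as a `∀`-hypothesis over EVERY
semistable-at-`3` twin and EVERY Heegner field, but USES it exactly once: at the twin `W′` the leaf
`WAllExclAddWildRankOneSurjTwin` hands over, and at the Friedberg–Hoffstein field `K` the kernel itself
chooses AFTER the twin (auxiliary modulus `2·N(E′)`, so `2` splits and `d_K ≡ 1 (mod 8)` is odd). This
file records the consequences, all pure logic over the landed kernel (its proof re-run verbatim with the
`∀`-hypothesis replaced by the pointwise one):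

* §1 `bsdp_three_of_twinIMCAt` — the POINTWISE kernel: published inputs, transport, Waldspurger frame,
  control, rank-zero twist, and crux #3's conclusion `(i) ∧ (ii)` for THE GIVEN twin `W′` at every
  Heegner `K` with `d_K` odd ⟹ `BSD₃(E)`.
* §2 `bsdp_three_of_oddDiscBuckets` / `wAllExclAddWildRankOneSurjTwin_of_oddDiscBuckets` — the kernel's
  conclusion, resp. the leaf BY NAME, from the three ODD-`d_K` children of crux #3 only (bucket A by the
  printed facts `TwinSplitIMCAtThreePrintedFacts` via the closed child `TwinSplitIMCAtThreeGoodOrdOfPrint`,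
  whose item 20693 is CLOSED by `twinSplitIMCAtThreeGoodOrdOfPrint_proof`, bucket B `TwinSplitIMCAtThreeMult`,
  bucket C `TwinSplitIMCAtThreeGoodSS`): the parked child
  `TwinSplitIMCAtThreeEvenDisc` (item 20696) is NOT load-bearing for the leaf (kernel certificate of the
  route file's prose «MOOT for the route»).
* §3 `bsdp_three_of_oddDiscBuckets_of_goodSSApZero_of_supply` /
  `wAllExclAddWildRankOneSurjTwin_of_oddDiscBuckets_of_goodSSApZero_of_supply` — the same with bucket C's
  child RESTRICTED TO `a₃(E′) = 0` (the text of item 20695 with `W′.frobeniusTrace 3 = 0` inserted),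
  granted the SUPPLY statement «a class that has a good-supersingular twin has one with `a₃ = 0`»
  (displayed as a hypothesis; census TWIN-PRINT-AT3-v1 §2: an `a₃ = 0` twin is WITNESSED in 603/603
  bucket-C classes; on paper: every good-supersingular `E′/ℚ₃` has `E′[3]|G_{ℚ₃} ≅ Ind ω₂` — Serre 1972
  §1.11 — so `y² = x³ − x` or its `2`-isogenous curve gives a symplectic `ℚ₃`-point of `X_E(3) ≅ ℙ¹`
  (Rubin–Silverberg 1995), and weak approximation gives a rational twin `3`-adically close to it). Hence
  the `a₃ = ±3` sub-case of item 20695 — the half with NO refereed mechanism even at the level of a port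
  (Castella–Çiperiani–Skinner–Sprung 2018 ♯/♭, preprint; memo SUPSET-AT3-v8 §2) — is not load-bearing
  for the leaf either, modulo that supply statement.

HONEST FRAMING: conditional results (every crux and the supply statement are displayed hypotheses);
nothing here closes an item; BSD is not proved for any curve by this file. No definition, no named
fact, no `sorry`. Beyond-print theorem: NO.

References: the kernel's — [JetchevSkinnerWan2017] §7.4.1; [Castella2018] Thm. 2.3, §5; [GrossZagier1986]
Thm. I.(6.3), V.§2; [FriedbergHoffstein1995] Thm. B — and, for the supply statement's provenance,
Serre, Invent. Math. 15 (1972) §1.11 Prop. 12; Rubin–Silverberg, «Families of elliptic curves with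
constant mod p representations» (1995) Thm. 4.1 / §4 (p = 3).
-/

noncomputable section

open scoped Classical

set_option linter.dupNamespace false
set_option autoImplicit false

namespace Summit.BirchSwinnertonDyer.BirchSwinnertonDyer.Theorems.UniversalToricDescentTwinChoice

open WeierstrassCurve NumberField IsDedekindDomain Field
  Literature.NumberTheory.EllipticCurves
  Literature.NumberTheory.EllipticCurves.ModularForms
  Literature.NumberTheory.EllipticCurves.Rank1Residual
  Literature.NumberTheory.EllipticCurves.KrizLi2019
  Summit.BirchSwinnertonDyer.Rank1Residual
  Summit.BirchSwinnertonDyer.Rank1Residual.Additive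
  Summit.BirchSwinnertonDyer.Rank1Residual.X11b
  Summit.BirchSwinnertonDyer.Rank1Residual.X11b.AcSelmer
  Summit.BirchSwinnertonDyer.Rank1Residual.X11b.Halves
  Summit.BirchSwinnertonDyer.BirchSwinnertonDyer.Theses.UniversalToricDescent
  Summit.BirchSwinnertonDyer.BirchSwinnertonDyer.Theorems

/-! ### §1. The pointwise kernel -/

/-- **Pointwise kernel.** Published inputs → transport → Waldspurger frame → control → rank-zero twist,
and crux #3's conclusion `(i) ∃ BDP frame ∧ (ii) every-frame equality` for THE GIVEN semistable twin
`W′` of `W` at every Heegner field `K` (for `N(E′)`) with `d_K` ODD ⟹ `BSD₃(E)` for `E` (= `W`) on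
`ClassO6 W 3` with `r_an = 1` and `ρ̄_{E,3}` onto. The proof is the kernel
`universalToricDescent_toricKernelAtThree_proof` verbatim, its single call of `TwinSplitIMCAtThree` replaced
by the pointwise hypothesis `hI'` (the kernel's `K` has `2` split, hence `d_K` odd).
[cite: JetchevSkinnerWan2017, §7.4.1 (arXiv:1512.06894 p. 30)] [cite: FriedbergHoffstein1995, Thm. B] -/
theorem bsdp_three_of_twinIMCAt (hF : ToricPublishedInputs) (hT : ToricTransportModThree)
    (hV : WildSplitWaldspurgerAtThree) (hC : WildSplitControlAtThree) (hZ : WildRankZeroTwistAtThree)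
    (W : WeierstrassCurve ℚ) [W.IsElliptic] [W.IsGloballyMinimal]
    (hO6 : Additive.ClassO6 W 3) (hr : W.analyticRank = 1) (hsurj : W.HasSurjectiveModNGaloisRep 3)
    (W' : WeierstrassCurve ℚ) [W'.IsElliptic] [W'.IsGloballyMinimal]
    (hcong : O6.ModPCongruent W' W 3) (hW'ss : ¬ Addv W' 3)
    (hI' : ∀ (N' : ℕ) [NeZero N'] (K : Type) [Field K] [NumberField K]
      (Dt' : ModularParametrizationData W' N'), W'.conductorNorm ℤ = N' → IsImaginaryQuadratic K →
      SatisfiesHeegnerHypothesis N' K → Odd (NumberField.discr K) →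
      ∀ (κ : ZpExtension K 3), κ.IsAnticyclotomic →
      ∀ (γ : absoluteGaloisGroup K) [Fact (κ.IsTopGenerator γ)] (𝔭 : HeightOneSpectrum (𝓞 K)),
        ((3 : ℕ) : 𝓞 K) ∈ 𝔭.asIdeal → 𝔭.asIdeal.ramificationIdx (𝓞 ℚ) = 1 →
        𝔭.asIdeal.inertiaDeg (𝓞 ℚ) = 1 →
      ∀ (𝔭' : HeightOneSpectrum (𝓞 K)), ((3 : ℕ) : 𝓞 K) ∈ 𝔭'.asIdeal → 𝔭' ≠ 𝔭 →
      ∀ (ι' : PadicAlgCl 3 ≃+* ℂ), SchneiderFree.BranchInducesPrime 3 ι' 𝔭 →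
        (∃ (ΩK : ℂ) (Ωp : ℂ_[3]) (L' : UnrSeries 3), ΩK ≠ 0 ∧ Ωp ≠ 0 ∧
          IsBDPLFunction ι' 𝔭 κ γ Dt'.f ΩK Ωp L') ∧
        (∀ (ΩK : ℂ) (Ωp : ℂ_[3]) (L' : UnrSeries 3), ΩK ≠ 0 → Ωp ≠ 0 →
          IsBDPLFunction ι' 𝔭 κ γ Dt'.f ΩK Ωp L' →
          (XAc.charIdeal (W'.baseChange K) 3 κ 𝔭' ∅ γ).map (PowerSeries.map (toUnr 3)) =
            Ideal.span {L'})) :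
    BSDp W 3 := by
  obtain ⟨hGZ, hKo, hGZK, hmod, hmodP, -, hGZ73, hFH, hpar, hHP⟩ := hF
  haveI hN0 : NeZero (W.conductorNorm ℤ) := ⟨W.conductorNorm_pos_holds.ne'⟩
  haveI hN0' : NeZero (W'.conductorNorm ℤ) := ⟨W'.conductorNorm_pos_holds.ne'⟩
  -- (a) DATA. parity: `r_an = 1` is odd, so `w(E) = -1`
  have hw : W.rootNumber = -1 := by
    rcases W.rootNumber_eq_one_or with h | h
    · exfalso
      have heven : Even W.analyticRank := (hpar W).mpr h
      rw [hr] at heven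
      exact Nat.not_even_one heven
    · exact h
  -- Friedberg–Hoffstein with auxiliary modulus `2·N(E′)`: Heegner for `N(E)`, `N(E′)`, and `2` split
  obtain ⟨K, _, _, hK, -, hHN, hH2N', hLt⟩ :=
    hFH W hw (2 * W'.conductorNorm ℤ) (mul_ne_zero two_ne_zero hN0'.out) 0
  have hHN' : SatisfiesHeegnerHypothesis (W'.conductorNorm ℤ) K :=
    SatisfiesHeegnerHypothesis.of_dvd (dvd_mul_left _ 2) hH2N'
  have hodd : Odd (NumberField.discr K) := by
    have h8 := Literature.SatisfiesHeegnerHypothesis.discr_emod_eight hK.1 hH2N' (dvd_mul_right 2 _)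
    rw [Int.odd_iff]; omega
  -- `3 ∣ N(E)` (additive) splits in `K`
  have h3N : 3 ∣ W.conductorNorm ℤ :=
    (W.dvd_conductorNorm_iff_not_hasGoodReductionAtPrime 3).mpr (not_good_of_addv W 3 hO6.2.1)
  have hsplit : SplitsIn K 3 := hHN 3 Nat.prime_three h3N
  -- the Heegner point over `K` and its data; non-torsion by Gross–Zagier
  obtain ⟨P, Dt, H, ι, hP⟩ := hHP W K hK hHN
  have hL0 : W.entireLFunction 1 = 0 := entireLFunction_one_eq_zero_of_analyticRank_eq_one hr
  obtain ⟨-, hderiv⟩ := leadingLCoeff_eq_deriv_of_analyticRank_eq_one hr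
  have hLK : LDerivEK W K ≠ 0 := by
    rw [lDerivEK_eq_deriv_mul W K hmod hL0]; exact mul_ne_zero hderiv hLt
  have hnt : ¬ IsOfFinAddOrder P :=
    (lDerivEK_ne_zero_iff_not_isOfFinAddOrder W (W.conductorNorm ℤ) K (hGZ _ W K) hK hHN
      ⟨Dt, H, ι, hP⟩).mp hLK
  -- Kolyvagin: `rank E(K) = 1`, `Ш(E/K)` finite
  obtain ⟨hrk, hfin⟩ := hKo (W.conductorNorm ℤ) W K hK hHN ⟨Dt, H, ι, hP⟩ hnt
  -- the twin's parametrisation datum (modularity)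
  obtain ⟨Dt'⟩ := hmodP W'
  -- a frame `(κ, γ, 𝔭)` and the other prime `𝔭′ ≠ 𝔭` above `3`
  obtain ⟨κ, γ, -, hκ, hγ, -⟩ := X11b.exists_anticyclotomic_generator_prime (p := 3) hK
  haveI : Fact (κ.IsTopGenerator γ) := ⟨hγ⟩
  obtain ⟨𝔭, h𝔭, he, hf⟩ := X11b.exists_degreeOnePrime_of_splitsIn K 3 hK.1 hsplit
  obtain ⟨𝔭', hne, h𝔭', he', hf'⟩ := X11b.Three.exists_ne_degreeOne_prime hK.1 h𝔭 he hf
  -- (b) PLUMBING. Waldspurger frame and unit value at `(κ, γ, 𝔭)`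
  obtain ⟨ι', hind, ΩK, Ωp, L, hΩK, hΩp, hBDP, u, hval⟩ :=
    hV W (W.conductorNorm ℤ) K Dt H ι P hO6 hsurj hr rfl hK hHN hLt hP hnt κ hκ γ 𝔭 h𝔭 he hf
  -- the twin's IMC at `(ι′, 𝔭)` with `X_ac` strict at `𝔭′` — POINTWISE, at this `W′` and this odd-`d_K` `K`
  obtain ⟨hex', hall'⟩ := hI' (W'.conductorNorm ℤ) K Dt' rfl hK hHN' hodd κ hκ γ 𝔭 h𝔭 he hf 𝔭' h𝔭' hne ι' hind
  -- transport: IMC EQUALITY for `E` at the frame `L`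
  have heq : (XAc.charIdeal (W.baseChange K) 3 κ 𝔭' ∅ γ).map (PowerSeries.map (toUnr 3)) =
      Ideal.span {L} :=
    hT W W' (W.conductorNorm ℤ) (W'.conductorNorm ℤ) K Dt Dt' hO6 hsurj hr rfl hcong hW'ss rfl hK hHN
      hHN' κ hκ γ 𝔭 h𝔭 he hf 𝔭' h𝔭' hne ι' hind hex' hall' ΩK Ωp L hΩK hΩp hBDP
  -- control EQUALITY at `𝔭′` (CTL₀ included)
  have hctl : SchneiderFree.AdditiveControlOnTreeAt 3 κ 𝔭' γ (embAt K 3 𝔭' h𝔭' he' hf') P :=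
    hC W (W.conductorNorm ℤ) K Dt H ι P hO6 hsurj hr rfl hK hHN hLt hP hnt (hKo _ W K) κ hκ γ 𝔭'
      h𝔭' he' hf'
  obtain ⟨n, hn, hneq⟩ := hctl
  -- the value read through the logarithm at `𝔭′` (rank one: `(log_{𝔭′} P)² = (log_𝔭 P)²`)
  have hval' : L.HasValueAt 0 ((((u : unrIntegers 3) : unrIntegers 3) : ℂ_[3]) *
      (algebraMap ℚ_[3] ℂ_[3]
        (logOmega W 3 (embAt K 3 𝔭' h𝔭' he' hf') P / (Dt.c : ℚ_[3]))) ^ 2) :=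
    (SchneiderFreeAdditiveX3.hasValueAt_sq_logOmega_embAt_iff_of_rank_one W 3 hK.1 hrk h𝔭 he hf
      h𝔭' he' hf' P _ _ L).mpr hval
  -- both sockets at slack `v₃(c)` at the frame `(κ, 𝔭′, γ, embAt 𝔭′)`
  have hc0 : Dt.c ≠ 0 := Dt.maninConstant_ne_zero_holds
  have hlog : logOmega W 3 (embAt K 3 𝔭' h𝔭' he' hf') P ≠ 0 := X11b.R1.logOmega_ne_zero W 3 _ hnt
  have hlow : SchneiderFree.AdditiveIMCLowerBDPOnTreeLeAt 3 κ 𝔭' γ (embAt K 3 𝔭' h𝔭' he' hf')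
      (padicValNat 3 Dt.c.natAbs) P := by
    -- the LOWER norm receptacle (`⊆` + value): `2·ord₃(log_{𝔭′}P / c) ≤ ord₃ f(0)`
    obtain ⟨htors, f, hfI, hf0, hfn⟩ := hn
    have hmem : PowerSeries.map (toUnr 3) f ∈ Ideal.span {L} := by
      have h3 := heq.le
      rw [hfI, CongruenceLimit.map_span_singleton_powerSeries] at h3
      exact (Ideal.span_singleton_le_iff_mem _).mp h3
    obtain ⟨-, hle⟩ := Supersingular.two_mul_valuation_le_of_mem_span 3 hf0 hmem u hval'
    have hc0' : (Dt.c : ℚ_[3]) ≠ 0 := by exact_mod_cast hc0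
    rw [div_eq_mul_inv, Padic.valuation_mul hlog (inv_ne_zero hc0'), Padic.valuation_inv,
      Padic.valuation_intCast, valuation_logOmega hlog, hfn] at hle
    refine ⟨n, ⟨htors, f, hfI, hf0, hfn⟩, ?_⟩
    simp only [padicValInt] at hle
    linarith
  have hup : SchneiderFree.Upper.AdditiveIMCUpperBDPOnTreeLeAt 3 κ 𝔭' γ (embAt K 3 𝔭' h𝔭' he' hf')
      (padicValNat 3 Dt.c.natAbs) P :=
    SchneiderFree.Upper.additiveIMCUpperBDPOnTreeLeAt_of_value_of_dvd' hn heq.ge u hc0 hlog hval'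
  -- the EXACT index at slack `v₃(c)` (both halves), by K1's links with the control equality
  have hlo : SchneiderFree.IndexLowerBoundLeAt W 3 K P (padicValNat 3 Dt.c.natAbs) :=
    SchneiderFreeAdditiveX3.indexLowerBoundLeAt_of_imcLowerLe_of_control rfl hK hHN hfin hlow
      ⟨n, hn, hneq⟩
  have hupI : SchneiderFree.Upper.IndexUpperBoundLeAt W 3 K P (padicValNat 3 Dt.c.natAbs) :=
    SchneiderFree.Upper.indexUpperBoundLeAt_of_imcUpperLe_of_control rfl hK hHN hfin hup ⟨n, hn, hneq⟩
  -- (c) TERMINAL STEP: a globally minimal model of the twist, then p528981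
  have hD0 : (NumberField.discr K : ℚ) ≠ 0 := by exact_mod_cast NumberField.discr_ne_zero K
  haveI : (W.quadraticTwist (NumberField.discr K : ℚ)).IsElliptic := W.isElliptic_quadraticTwist hD0
  obtain ⟨Cd, hCd⟩ := hasGlobalMinimalModel_rat_holds (W.quadraticTwist (NumberField.discr K : ℚ))
  haveI : (Cd • W.quadraticTwist (NumberField.discr K : ℚ)).IsGloballyMinimal := hCd
  exact SchneiderFree.Exact.bsdp_three_of_exactIndexManin_of_wAllExclAddWildRankZero hGZ hKo hGZK hmod
    hGZ73 hZ W hO6 hsurj hr (W.conductorNorm ℤ) K Dt H ι P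
    (Cd • W.quadraticTwist (NumberField.discr K : ℚ)) rfl hK hodd hHN hLt hP ⟨Cd, rfl⟩ hlo hupI

/-! ### §2. The kernel and the leaf from the three odd-`d_K` children of crux #3 (EvenDisc moot) -/

/-- **Kernel conclusion from the odd-`d_K` buckets only.** Published inputs, transport, the three printed
facts of bucket A (`TwinSplitIMCAtThreePrintedFacts`, consumed through the CLOSED child
`TwinSplitIMCAtThreeGoodOrdOfPrint` — displayed as `hA`, discharged in the tree by
`twinSplitIMCAtThreeGoodOrdOfPrint_proof`, not imported here to keep this module off that module's cone),
bucket B's crux `TwinSplitIMCAtThreeMult`, bucket C's crux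
`TwinSplitIMCAtThreeGoodSS`, Waldspurger frame, control and rank-zero twist ⟹ `BSD₃(E)` on the whole
attacked cell: the EVEN-`d_K` child `TwinSplitIMCAtThreeEvenDisc` (item 20696) is not needed, because the
kernel's Heegner field has `2` split. Trichotomy good-ordinary / good-supersingular / multiplicative of
the twin at `3` under `¬ Addv`. [folklore] -/
theorem bsdp_three_of_oddDiscBuckets (hF : ToricPublishedInputs) (hT : ToricTransportModThree)
    (hP : TwinSplitIMCAtThreePrintedFacts) (hA : TwinSplitIMCAtThreeGoodOrdOfPrint)
    (hB : TwinSplitIMCAtThreeMult) (hS : TwinSplitIMCAtThreeGoodSS) (hV : WildSplitWaldspurgerAtThree)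
    (hC : WildSplitControlAtThree) (hZ : WildRankZeroTwistAtThree) :
    ∀ (W : WeierstrassCurve ℚ) [W.IsElliptic] [W.IsGloballyMinimal], Additive.ClassO6 W 3 →
      W.analyticRank = 1 → W.HasSurjectiveModNGaloisRep 3 →
      (∃ (W' : WeierstrassCurve ℚ) (_ : W'.IsElliptic) (_ : W'.IsGloballyMinimal),
        O6.ModPCongruent W' W 3 ∧ ¬ Addv W' 3 ∧ W'.HasSurjectiveModNGaloisRep 3) → BSDp W 3 := by
  intro W _ _ hO6 hr hsurj htwin
  obtain ⟨W', hW'e, hW'm, hcong, hW'ss, hW'surj⟩ := htwin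
  refine bsdp_three_of_twinIMCAt hF hT hV hC hZ W hO6 hr hsurj W' hcong hW'ss ?_
  intro N' _ K _ _ Dt' hN hK hH hodd κ hκ γ _ 𝔭 h𝔭 he hf 𝔭' h𝔭' hne ι' hι
  by_cases hgood : W'.HasGoodReductionAtPrime 3
  · by_cases hss : (3 : ℤ) ∣ W'.frobeniusTrace 3
    · exact hS W' N' K Dt' ⟨hgood, by exact_mod_cast hss⟩ hW'surj hN hK hH hodd κ hκ γ 𝔭 h𝔭 he hf 𝔭'
        h𝔭' hne ι' hι
    · exact hA hP.1 hP.2.1 hP.2.2 W' N' K Dt' ⟨hgood, by exact_mod_cast hss⟩ hW'surj hN hK hH hodd κ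
        hκ γ 𝔭 h𝔭 he hf 𝔭' h𝔭' hne ι' hι
  · have hmult : W'.HasMultiplicativeReductionAtPrime 3 := by
      by_contra h
      exact hW'ss ⟨hgood, h⟩
    exact hB W' N' K Dt' hmult hW'surj hN hK hH hodd κ hκ γ 𝔭 h𝔭 he hf 𝔭' h𝔭' hne ι' hι

/-- **The leaf `WAllExclAddWildRankOneSurjTwin` BY NAME from the odd-`d_K` buckets** (same hypotheses as
`bsdp_three_of_oddDiscBuckets`; the `¬ HasCM` binder of the leaf is unused, as in the route's `closes`).
[folklore] -/
theorem wAllExclAddWildRankOneSurjTwin_of_oddDiscBuckets (hF : ToricPublishedInputs)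
    (hT : ToricTransportModThree) (hP : TwinSplitIMCAtThreePrintedFacts)
    (hA : TwinSplitIMCAtThreeGoodOrdOfPrint) (hB : TwinSplitIMCAtThreeMult)
    (hS : TwinSplitIMCAtThreeGoodSS) (hV : WildSplitWaldspurgerAtThree) (hC : WildSplitControlAtThree)
    (hZ : WildRankZeroTwistAtThree) : Summit.BirchSwinnertonDyer.WAllExclAddWildRankOneSurjTwin :=
  Summit.BirchSwinnertonDyer.wAllExclAddWildRankOneSurjTwin_of_forall
    (bsdp_three_of_oddDiscBuckets hF hT hP hA hB hS hV hC hZ)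

/-! ### §3. Bucket C restricted to `a₃ = 0`, granted the supply of an `a₃ = 0` twin -/

/-- **Kernel conclusion with bucket C's crux RESTRICTED TO `a₃(E′) = 0`, granted the supply statement.**
As `bsdp_three_of_oddDiscBuckets`, but the good-supersingular hypothesis `hS0` is item 20695's text with
`W′.frobeniusTrace 3 = 0` inserted after `GoodSS W′ 3` (the Castella–Wan / Kobayashi `a_p = 0` shape), and
`hsupply` displays «every `E` with a good-supersingular-at-`3` twin `E′` (`E′[3] ≃ E[3]` `Γ_ℚ`-equivariantly)
has such a twin with `a₃ = 0`». If the handed twin is good supersingular with `a₃ = ±3`, it is traded for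
the supplied `a₃ = 0` twin `W″` (again `ρ̄₃` onto by transport from `W`, good hence not additive at `3`)
before the pointwise kernel is run. [folklore] -/
theorem bsdp_three_of_oddDiscBuckets_of_goodSSApZero_of_supply (hF : ToricPublishedInputs)
    (hT : ToricTransportModThree) (hP : TwinSplitIMCAtThreePrintedFacts)
    (hA : TwinSplitIMCAtThreeGoodOrdOfPrint) (hB : TwinSplitIMCAtThreeMult)
    (hS0 : ∀ (W' : WeierstrassCurve ℚ) [W'.IsElliptic] [W'.IsGloballyMinimal] (N' : ℕ) [NeZero N']
      (K : Type) [Field K] [NumberField K] (Dt' : ModularParametrizationData W' N'), GoodSS W' 3 →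
      W'.frobeniusTrace 3 = 0 → W'.HasSurjectiveModNGaloisRep 3 → W'.conductorNorm ℤ = N' →
      IsImaginaryQuadratic K → SatisfiesHeegnerHypothesis N' K → Odd (NumberField.discr K) →
      ∀ (κ : ZpExtension K 3), κ.IsAnticyclotomic →
      ∀ (γ : absoluteGaloisGroup K) [Fact (κ.IsTopGenerator γ)] (𝔭 : HeightOneSpectrum (𝓞 K)),
        ((3 : ℕ) : 𝓞 K) ∈ 𝔭.asIdeal → 𝔭.asIdeal.ramificationIdx (𝓞 ℚ) = 1 →
        𝔭.asIdeal.inertiaDeg (𝓞 ℚ) = 1 →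
      ∀ (𝔭' : HeightOneSpectrum (𝓞 K)), ((3 : ℕ) : 𝓞 K) ∈ 𝔭'.asIdeal → 𝔭' ≠ 𝔭 →
      ∀ (ι' : PadicAlgCl 3 ≃+* ℂ), SchneiderFree.BranchInducesPrime 3 ι' 𝔭 →
        (∃ (ΩK : ℂ) (Ωp : ℂ_[3]) (L' : UnrSeries 3), ΩK ≠ 0 ∧ Ωp ≠ 0 ∧
          IsBDPLFunction ι' 𝔭 κ γ Dt'.f ΩK Ωp L') ∧
        (∀ (ΩK : ℂ) (Ωp : ℂ_[3]) (L' : UnrSeries 3), ΩK ≠ 0 → Ωp ≠ 0 →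
          IsBDPLFunction ι' 𝔭 κ γ Dt'.f ΩK Ωp L' →
          (XAc.charIdeal (W'.baseChange K) 3 κ 𝔭' ∅ γ).map (PowerSeries.map (toUnr 3)) =
            Ideal.span {L'}))
    (hsupply : ∀ (W : WeierstrassCurve ℚ) [W.IsElliptic] [W.IsGloballyMinimal]
      (W' : WeierstrassCurve ℚ) [W'.IsElliptic] [W'.IsGloballyMinimal],
      O6.ModPCongruent W' W 3 → GoodSS W' 3 →
      ∃ (W'' : WeierstrassCurve ℚ) (_ : W''.IsElliptic) (_ : W''.IsGloballyMinimal),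
        O6.ModPCongruent W'' W 3 ∧ GoodSS W'' 3 ∧ W''.frobeniusTrace 3 = 0)
    (hV : WildSplitWaldspurgerAtThree) (hC : WildSplitControlAtThree) (hZ : WildRankZeroTwistAtThree) :
    ∀ (W : WeierstrassCurve ℚ) [W.IsElliptic] [W.IsGloballyMinimal], Additive.ClassO6 W 3 →
      W.analyticRank = 1 → W.HasSurjectiveModNGaloisRep 3 →
      (∃ (W' : WeierstrassCurve ℚ) (_ : W'.IsElliptic) (_ : W'.IsGloballyMinimal),
        O6.ModPCongruent W' W 3 ∧ ¬ Addv W' 3 ∧ W'.HasSurjectiveModNGaloisRep 3) → BSDp W 3 := by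
  intro W _ _ hO6 hr hsurj htwin
  obtain ⟨W', hW'e, hW'm, hcong, hW'ss, hW'surj⟩ := htwin
  by_cases hgood : W'.HasGoodReductionAtPrime 3
  · by_cases hss : (3 : ℤ) ∣ W'.frobeniusTrace 3
    · -- good supersingular: trade `W′` for a supplied twin `W″` with `a₃ = 0`
      obtain ⟨W'', hW''e, hW''m, hcong'', hW''ss, ha0⟩ :=
        hsupply W W' hcong ⟨hgood, by exact_mod_cast hss⟩
      have hW''surj : W''.HasSurjectiveModNGaloisRep 3 := by
        -- transport of `ρ̄₃` onto along the inverse equivariant isomorphism (utd-p1's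
        -- `UniversalToricDescentReduction.hasSurjectiveModNGaloisRep_of_modPCongruent`, inlined route-free)
        obtain ⟨e, he⟩ := hcong''
        refine GaloisImage.hasSurjectiveModNGaloisRep_of_torsionIso e.symm (fun σ Q ↦ ?_) hsurj
        apply e.injective
        rw [he, e.apply_symm_apply, e.apply_symm_apply]
      have hW''na : ¬ Addv W'' 3 := fun h ↦ h.1 hW''ss.1
      refine bsdp_three_of_twinIMCAt hF hT hV hC hZ W hO6 hr hsurj W'' hcong'' hW''na ?_
      intro N'' _ K _ _ Dt'' hN hK hH hodd κ hκ γ _ 𝔭 h𝔭 he hf 𝔭' h𝔭' hne ι' hι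
      exact hS0 W'' N'' K Dt'' hW''ss ha0 hW''surj hN hK hH hodd κ hκ γ 𝔭 h𝔭 he hf 𝔭' h𝔭' hne ι' hι
    · -- good ordinary: bucket A by the printed facts
      refine bsdp_three_of_twinIMCAt hF hT hV hC hZ W hO6 hr hsurj W' hcong hW'ss ?_
      intro N' _ K _ _ Dt' hN hK hH hodd κ hκ γ _ 𝔭 h𝔭 he hf 𝔭' h𝔭' hne ι' hι
      exact hA hP.1 hP.2.1 hP.2.2 W' N' K Dt' ⟨hgood, by exact_mod_cast hss⟩ hW'surj hN hK hH hodd κ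
        hκ γ 𝔭 h𝔭 he hf 𝔭' h𝔭' hne ι' hι
  · -- multiplicative: bucket B
    have hmult : W'.HasMultiplicativeReductionAtPrime 3 := by
      by_contra h
      exact hW'ss ⟨hgood, h⟩
    refine bsdp_three_of_twinIMCAt hF hT hV hC hZ W hO6 hr hsurj W' hcong hW'ss ?_
    intro N' _ K _ _ Dt' hN hK hH hodd κ hκ γ _ 𝔭 h𝔭 he hf 𝔭' h𝔭' hne ι' hι
    exact hB W' N' K Dt' hmult hW'surj hN hK hH hodd κ hκ γ 𝔭 h𝔭 he hf 𝔭' h𝔭' hne ι' hι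

/-- **The leaf `WAllExclAddWildRankOneSurjTwin` BY NAME with bucket C's crux restricted to `a₃ = 0`,
granted the supply statement** (hypotheses of `bsdp_three_of_oddDiscBuckets_of_goodSSApZero_of_supply`).
So, modulo the supply of an `a₃ = 0` twin, the `a₃ = ±3` sub-case of item 20695 is not load-bearing for
the W-ALL leaf. [folklore] -/
theorem wAllExclAddWildRankOneSurjTwin_of_oddDiscBuckets_of_goodSSApZero_of_supply
    (hF : ToricPublishedInputs) (hT : ToricTransportModThree) (hP : TwinSplitIMCAtThreePrintedFacts)
    (hA : TwinSplitIMCAtThreeGoodOrdOfPrint) (hB : TwinSplitIMCAtThreeMult)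
    (hS0 : ∀ (W' : WeierstrassCurve ℚ) [W'.IsElliptic] [W'.IsGloballyMinimal] (N' : ℕ) [NeZero N']
      (K : Type) [Field K] [NumberField K] (Dt' : ModularParametrizationData W' N'), GoodSS W' 3 →
      W'.frobeniusTrace 3 = 0 → W'.HasSurjectiveModNGaloisRep 3 → W'.conductorNorm ℤ = N' →
      IsImaginaryQuadratic K → SatisfiesHeegnerHypothesis N' K → Odd (NumberField.discr K) →
      ∀ (κ : ZpExtension K 3), κ.IsAnticyclotomic →
      ∀ (γ : absoluteGaloisGroup K) [Fact (κ.IsTopGenerator γ)] (𝔭 : HeightOneSpectrum (𝓞 K)),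
        ((3 : ℕ) : 𝓞 K) ∈ 𝔭.asIdeal → 𝔭.asIdeal.ramificationIdx (𝓞 ℚ) = 1 →
        𝔭.asIdeal.inertiaDeg (𝓞 ℚ) = 1 →
      ∀ (𝔭' : HeightOneSpectrum (𝓞 K)), ((3 : ℕ) : 𝓞 K) ∈ 𝔭'.asIdeal → 𝔭' ≠ 𝔭 →
      ∀ (ι' : PadicAlgCl 3 ≃+* ℂ), SchneiderFree.BranchInducesPrime 3 ι' 𝔭 →
        (∃ (ΩK : ℂ) (Ωp : ℂ_[3]) (L' : UnrSeries 3), ΩK ≠ 0 ∧ Ωp ≠ 0 ∧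
          IsBDPLFunction ι' 𝔭 κ γ Dt'.f ΩK Ωp L') ∧
        (∀ (ΩK : ℂ) (Ωp : ℂ_[3]) (L' : UnrSeries 3), ΩK ≠ 0 → Ωp ≠ 0 →
          IsBDPLFunction ι' 𝔭 κ γ Dt'.f ΩK Ωp L' →
          (XAc.charIdeal (W'.baseChange K) 3 κ 𝔭' ∅ γ).map (PowerSeries.map (toUnr 3)) =
            Ideal.span {L'}))
    (hsupply : ∀ (W : WeierstrassCurve ℚ) [W.IsElliptic] [W.IsGloballyMinimal]
      (W' : WeierstrassCurve ℚ) [W'.IsElliptic] [W'.IsGloballyMinimal],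
      O6.ModPCongruent W' W 3 → GoodSS W' 3 →
      ∃ (W'' : WeierstrassCurve ℚ) (_ : W''.IsElliptic) (_ : W''.IsGloballyMinimal),
        O6.ModPCongruent W'' W 3 ∧ GoodSS W'' 3 ∧ W''.frobeniusTrace 3 = 0)
    (hV : WildSplitWaldspurgerAtThree) (hC : WildSplitControlAtThree) (hZ : WildRankZeroTwistAtThree) :
    Summit.BirchSwinnertonDyer.WAllExclAddWildRankOneSurjTwin :=
  Summit.BirchSwinnertonDyer.wAllExclAddWildRankOneSurjTwin_of_forall
    (bsdp_three_of_oddDiscBuckets_of_goodSSApZero_of_supply hF hT hP hA hB hS0 hsupply hV hC hZ)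

end Summit.BirchSwinnertonDyer.BirchSwinnertonDyer.Theorems.UniversalToricDescentTwinChoice

end
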